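/-
Copyright (c) 2026 the pub-hodgecm-mathlib formalisation cell (harness21).  Prover seat hodgecm-mathlib-K2E4-p23 (g0) (E4 base on loan to ENGINE E1), Track B ∕ K2-LIT,
h413 = `stmt-HodgeConjecture-24833`, campaign «EIS-R7-BL-SPH-2», brick P7 FILE B, ED. 2 as FILE C (dealer K2E1-plan (g5) DEAL 2026-09-04T09:08:16Z «P7 FILE B ED. 2 NOW»; RULING
«Z := B(F)∖G(𝔸)» 08:57:54Z): the weight `w₁` on `𝔛` re-indexed over `G(F)`, the lower bound `c₀ ≤ w₁`, MEMBERSHIP of a moderate-growth automorphic function in `𝓗_k(𝔛)`, and the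
«E ⊥ 𝒞_k» heads on the LEAF OF RECORD's cusp test class.
-/
import Summits.HodgeConjecture.HodgeConjecture.Theorems.K2E1BLEisensteinInWeightedSpaceU2   -- ★ p858763 (this seat) P7 FILE B ED. 1: «E ⊥ 𝒞_k» every rank (β-free, letter hX)
import Summits.HodgeConjecture.HodgeConjecture.Theorems.K2E1BLBorelSpacesU2Defs             -- ★ p858761 (K2E4-p10 g5) LEAF OF RECORD (Z = B(F)∖G(𝔸)): `supHeight`, `HX`, `cuspTestClass`
import Summits.HodgeConjecture.HodgeConjecture.Theorems.K2E1BLReductionCoveringU2           -- ★ p858727 (K2E1-p08 g6) BL-R1: `exists_pos_forall_lt_ciSup_borelHeight_mul_cm` (`c₀ < w₁`)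
import HarnessLib

/-!
# K2·E1 — `K2E1BLEisensteinInWeightedSpaceU2Weights` («EIS-R7-BL-SPH-2», P7 FILE B ED. 2 = FILE C): `w₁` on `𝔛`, `c₀ ≤ w₁`, moderate growth ⟹ `𝓗_k(𝔛)`, and «E ⊥ 𝒞_k» on the leaf of record

Track B ∕ K2-LIT, crux h413 = `stmt-HodgeConjecture-24833`, route of record `HCCMUnconditional`; cell `hodgecm-mathlib`, squad K2, ENGINE E1, campaign «EIS-R7-BL-SPH-2» ((ζ′) WIRING
7d1cceb628a30de8 §3 P7 (b1)(b3); RULING «Z := B(F)∖G(𝔸)» 08:57:54Z; DEAL 09:08:16Z).  Prover seat `hodgecm-mathlib-K2E4-p23` (g0).  THEOREMS ONLY (no `def`, no `instance`, no notation, no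
named-fact hypothesis, no `sorry`); lane `--supports stmt-HodgeConjecture-24833 --as helper` (count-neutral).  Closes no socket.  A separate FILE C because ★ FILE B (317 l.) + ED. 2 exceeds
the 400-line cap.

* §1 **THE LEAF-OF-RECORD TWINS of «E ⊥ 𝒞_k»**: ★ FILE B §3 typed the cusp test class of the (now deprecated) leaf p858686; the leaf of record ★ p858761 defines `cuspTestClass`∕`supHeight`
  by BYTE-IDENTICAL text (only `Z` changed, and these two objects live on `𝔛`, not on `Z`), so the heads transfer definitionally:
  `integral_quotFun_eisensteinSeriesU_mul_conj_eq_zero_of_mem_cuspTestClass_borel` (+ `_two`, `_three`).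
* §2 **`w₁` ON `𝔛`**: `supHeight_eq_ciSup_arithmetic` (re-index D5's `⨆` over `G(F) = Rational` through `toAdelic` as the `⨆` over the arithmetic subgroup, `arithmeticSubgroup = range toAdelic`);
  at the CM pair **`exists_pos_forall_le_supHeight_cm`**: `∃ c₀ > 0, ∀ x, c₀ ≤ w₁(x)` (★ BL-R1 `exists_pos_forall_lt_ciSup_borelHeight_mul_cm`).
* §3 **MODERATE GROWTH ⟹ `𝓗_k(𝔛)`** (the shape of (b1)): for a finite measure `μ` on `𝔛`, `w₁` measurable with `c₀ ≤ w₁` (`c₀ > 0`), and `Φ` on `𝔛` a.e.-strongly measurable with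
  `‖Φ x‖ ≤ C·w₁(x)^n`, **`memLp_two_withDensity_supHeight_of_norm_le_mul_pow`**: `Φ ∈ L²(𝔛; w₁^{−2k}μ)` for every `k ≥ n` (`‖Φ‖²·w₁^{−2k} ≤ C²·c₀^{−2(k−n)}`, Mathlib
  `integrable_withDensity_iff_integrable_smul`).  Letters: measurability of `w₁` on `𝔛` (P2a) and the pointwise moderate growth of `quotFun (E f)` in `w₁`-currency (★ (A3)₂ on Siegel sets +
  BL-R1's reduction `γ g ∈ 𝔖`; (b1)'s remaining glue).
HONEST LABEL: HC_CM is proved only modulo the 7 printed citations (2 remaining named inputs: hLiu418 = `stmt-HodgeConjecture-24832`, h413 = `stmt-HodgeConjecture-24833`)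
until rung 0 closes; this file asserts no named fact and closes no socket.
References: [BernsteinLapid2019] arXiv:1911.02342, §4 Claim 2, Claim 4 (p. 9–10) · [MoeglinWaldspurger1995] I.2.13, II.1.8 · [Borel1963] A. Borel, *Some finiteness properties of adele groups over
number fields*, §5.
-/

set_option autoImplicit false
-- the mandated namespace repeats the single-problem summit's segment (`HodgeConjecture.HodgeConjecture`)
set_option linter.dupNamespace false

noncomputable section

open MeasureTheory Measure NumberField IsDedekindDomain Set MulAction
open scoped ENNReal NNReal ComplexConjugate
open Literature.MeasureTheory.Group Literature.NumberTheory
open Literature.NumberTheory.Automorphic Literature.NumberTheory.Automorphic.UnitaryGroup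
open Summit.HodgeConjecture.HodgeConjecture.Cruxes.H413.K2E1BorelEisensteinU
open Summit.HodgeConjecture.HodgeConjecture.Cruxes.H413.K2E1BLEisensteinInWeightedSpaceU2
  (integral_quotFun_eisensteinSeriesU_mul_conj_eq_zero_of_mem_cuspTestClass integral_quotFun_eisensteinSeriesU_mul_conj_eq_zero_of_mem_cuspTestClass_two
    integral_quotFun_eisensteinSeriesU_mul_conj_eq_zero_of_mem_cuspTestClass_three)
open Summit.HodgeConjecture.HodgeConjecture.Cruxes.H413.K2E1BLReductionCoveringU2 (exists_pos_forall_lt_ciSup_borelHeight_mul_cm)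

namespace Summit.HodgeConjecture.HodgeConjecture.Cruxes.H413.K2E1BLEisensteinInWeightedSpaceU2Weights

variable {F E : Type} [Field F] [NumberField F] [Field E] [NumberField E] [Algebra F E] {c : E ≃ₐ[F] E} {N : ℕ}

/-! ## §1 «E ⊥ 𝒞_k» on the leaf of record's cusp test class -/

section Twins

variable [NeZero N] [MeasurableSpace (quasiSplit F E c N).Adelic] [BorelSpace (quasiSplit F E c N).Adelic]

/-- **«`E ⊥ 𝒞_k`», EVERY RANK, FOR THE LEAF OF RECORD's `cuspTestClass`** (★ p858761; definitionally the class of ★ FILE B §3). [cite: BernsteinLapid2019, §4 Claim 2] [cite: MoeglinWaldspurger1995, II.1.8] -/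
theorem integral_quotFun_eisensteinSeriesU_mul_conj_eq_zero_of_mem_cuspTestClass_borel
    (μ : Measure (quasiSplit F E c N).automorphicQuotient) [(quasiSplit F E c N).IsAutomorphicMeasure μ]
    (νG : Measure (quasiSplit F E c N).Adelic) [νG.IsHaarMeasure] [νG.IsInvInvariant]
    (νN : Measure ↥(adelicUnipotent F E c N)) [νN.IsHaarMeasure] [νN.IsInvInvariant]
    (hconj : ∀ b₀ (hb₀ : b₀ ∈ borelU (c : E →+* E) ((StdForm.antidiagonal N).over E)),
      νN.map (fun v : ↥(adelicUnipotent F E c N) => (⟨((quasiSplit F E c N).toAdelic b₀)⁻¹ * (v : (quasiSplit F E c N).Adelic) * (quasiSplit F E c N).toAdelic b₀,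
        conj_mem_adelicUnipotent ((K2E1PseudoEisensteinConstantTermU.toAdelic_mem_borelAdelic_iff b₀).2 hb₀) v.2⟩ : ↥(adelicUnipotent F E c N))) = νN)
    {𝓕 : Set ↥(adelicUnipotent F E c N)} (h𝓕 : IsFundamentalDomain ↥(rationalUnipotent F E c N) 𝓕 νN) (h𝓕₀ : νN 𝓕 ≠ 0) (h𝓕top : νN 𝓕 ≠ ∞)
    {f : (quasiSplit F E c N).Adelic → ℂ} (hfm : Measurable f)
    (hfN : ∀ (u : ↥(adelicUnipotent F E c N)) (g : (quasiSplit F E c N).Adelic), f ((u : (quasiSplit F E c N).Adelic) * g) = f g)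
    (hfB : ∀ b ∈ arithmeticBorel F E c N, ∀ x : (quasiSplit F E c N).Adelic, f ((b : (quasiSplit F E c N).Adelic) * x) = f x)
    {k : ℕ} {φ : (quasiSplit F E c N).Adelic → ℂ} (hφ : φ ∈ K2E1BLBorelSpacesU2Defs.cuspTestClass F E c N k νN 𝓕 μ) (hφm : Measurable φ)
    (hX : ∫⁻ x, (∑' q : Quotient (QuotientGroup.rightRel (arithmeticBorel F E c N)),
        ‖f (((q.out : (quasiSplit F E c N).arithmeticSubgroup) : (quasiSplit F E c N).Adelic) * (Quotient.out x : (quasiSplit F E c N).Adelic)⁻¹)‖ₑ) *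
          ‖(quasiSplit F E c N).quotFun φ x‖ₑ ∂μ < ∞) :
    ∫ x, (quasiSplit F E c N).quotFun (eisensteinSeriesU f) x * conj ((quasiSplit F E c N).quotFun φ x) ∂μ = 0 :=
  integral_quotFun_eisensteinSeriesU_mul_conj_eq_zero_of_mem_cuspTestClass μ νG νN hconj h𝓕 h𝓕₀ h𝓕top hfm hfN hfB hφ hφm hX

end Twins

section TwinsTwo

variable [MeasurableSpace (quasiSplit F E c 2).Adelic] [BorelSpace (quasiSplit F E c 2).Adelic]

/-- **`U(J₂)`: «`E ⊥ 𝒞_k`» for the leaf of record's class** (`c² = 1`, `c ≠ 1`). [cite: BernsteinLapid2019, §4 Claim 2] [cite: MoeglinWaldspurger1995, II.1.8] -/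
theorem integral_quotFun_eisensteinSeriesU_mul_conj_eq_zero_of_mem_cuspTestClass_borel_two (hc : c * c = 1) (hc1 : c ≠ 1)
    (μ : Measure (quasiSplit F E c 2).automorphicQuotient) [(quasiSplit F E c 2).IsAutomorphicMeasure μ]
    (νG : Measure (quasiSplit F E c 2).Adelic) [νG.IsHaarMeasure] [νG.IsInvInvariant]
    (νN : Measure ↥(adelicUnipotent F E c 2)) [νN.IsHaarMeasure] [νN.IsInvInvariant]
    {𝓕 : Set ↥(adelicUnipotent F E c 2)} (h𝓕 : IsFundamentalDomain ↥(rationalUnipotent F E c 2) 𝓕 νN) (h𝓕₀ : νN 𝓕 ≠ 0) (h𝓕top : νN 𝓕 ≠ ∞)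
    {f : (quasiSplit F E c 2).Adelic → ℂ} (hfm : Measurable f)
    (hfN : ∀ (u : ↥(adelicUnipotent F E c 2)) (g : (quasiSplit F E c 2).Adelic), f ((u : (quasiSplit F E c 2).Adelic) * g) = f g)
    (hfB : ∀ b ∈ arithmeticBorel F E c 2, ∀ x : (quasiSplit F E c 2).Adelic, f ((b : (quasiSplit F E c 2).Adelic) * x) = f x)
    {k : ℕ} {φ : (quasiSplit F E c 2).Adelic → ℂ} (hφ : φ ∈ K2E1BLBorelSpacesU2Defs.cuspTestClass F E c 2 k νN 𝓕 μ) (hφm : Measurable φ)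
    (hX : ∫⁻ x, (∑' q : Quotient (QuotientGroup.rightRel (arithmeticBorel F E c 2)),
        ‖f (((q.out : (quasiSplit F E c 2).arithmeticSubgroup) : (quasiSplit F E c 2).Adelic) * (Quotient.out x : (quasiSplit F E c 2).Adelic)⁻¹)‖ₑ) *
          ‖(quasiSplit F E c 2).quotFun φ x‖ₑ ∂μ < ∞) :
    ∫ x, (quasiSplit F E c 2).quotFun (eisensteinSeriesU f) x * conj ((quasiSplit F E c 2).quotFun φ x) ∂μ = 0 :=
  integral_quotFun_eisensteinSeriesU_mul_conj_eq_zero_of_mem_cuspTestClass_two hc hc1 μ νG νN h𝓕 h𝓕₀ h𝓕top hfm hfN hfB hφ hφm hX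

end TwinsTwo

section TwinsThree

variable [MeasurableSpace (quasiSplit F E c 3).Adelic] [BorelSpace (quasiSplit F E c 3).Adelic]

/-- **`U(J₃)`: «`E ⊥ 𝒞_k`» for the leaf of record's class** (`c² = 1`, `c ≠ 1`; the SPH-3 clone's input). [cite: BernsteinLapid2019, §4 Claim 2] [cite: MoeglinWaldspurger1995, II.1.8] -/
theorem integral_quotFun_eisensteinSeriesU_mul_conj_eq_zero_of_mem_cuspTestClass_borel_three (hc : c * c = 1) (hc1 : c ≠ 1)
    (μ : Measure (quasiSplit F E c 3).automorphicQuotient) [(quasiSplit F E c 3).IsAutomorphicMeasure μ]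
    (νG : Measure (quasiSplit F E c 3).Adelic) [νG.IsHaarMeasure] [νG.IsInvInvariant]
    (νN : Measure ↥(adelicUnipotent F E c 3)) [νN.IsHaarMeasure] [νN.IsInvInvariant]
    {𝓕 : Set ↥(adelicUnipotent F E c 3)} (h𝓕 : IsFundamentalDomain ↥(rationalUnipotent F E c 3) 𝓕 νN) (h𝓕₀ : νN 𝓕 ≠ 0) (h𝓕top : νN 𝓕 ≠ ∞)
    {f : (quasiSplit F E c 3).Adelic → ℂ} (hfm : Measurable f)
    (hfN : ∀ (u : ↥(adelicUnipotent F E c 3)) (g : (quasiSplit F E c 3).Adelic), f ((u : (quasiSplit F E c 3).Adelic) * g) = f g)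
    (hfB : ∀ b ∈ arithmeticBorel F E c 3, ∀ x : (quasiSplit F E c 3).Adelic, f ((b : (quasiSplit F E c 3).Adelic) * x) = f x)
    {k : ℕ} {φ : (quasiSplit F E c 3).Adelic → ℂ} (hφ : φ ∈ K2E1BLBorelSpacesU2Defs.cuspTestClass F E c 3 k νN 𝓕 μ) (hφm : Measurable φ)
    (hX : ∫⁻ x, (∑' q : Quotient (QuotientGroup.rightRel (arithmeticBorel F E c 3)),
        ‖f (((q.out : (quasiSplit F E c 3).arithmeticSubgroup) : (quasiSplit F E c 3).Adelic) * (Quotient.out x : (quasiSplit F E c 3).Adelic)⁻¹)‖ₑ) *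
          ‖(quasiSplit F E c 3).quotFun φ x‖ₑ ∂μ < ∞) :
    ∫ x, (quasiSplit F E c 3).quotFun (eisensteinSeriesU f) x * conj ((quasiSplit F E c 3).quotFun φ x) ∂μ = 0 :=
  integral_quotFun_eisensteinSeriesU_mul_conj_eq_zero_of_mem_cuspTestClass_three hc hc1 μ νG νN h𝓕 h𝓕₀ h𝓕top hfm hfN hfB hφ hφm hX

end TwinsThree

/-! ## §2 `w₁` on `𝔛`: re-indexing over the arithmetic subgroup, and `c₀ ≤ w₁` at the CM pair -/

section SupHeight

variable [NeZero N]

/-- **`w₁(x) = ⨆_{γ ∈ arithmeticSubgroup} H(γ·x̃⁻¹)`** — D5's supremum over `G(F) = Rational` through `toAdelic` is the supremum over the arithmetic subgroup `toAdelic(G(F))` (a surjective re-indexing,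
Mathlib `Function.Surjective.iSup_comp`). [cite: BernsteinLapid2019, §4 p. 10] -/
theorem supHeight_eq_ciSup_arithmetic (x : (quasiSplit F E c N).automorphicQuotient) :
    K2E1BLBorelSpacesU2Defs.supHeight F E c N x =
      ⨆ γ : (quasiSplit F E c N).arithmeticSubgroup, borelHeight ((γ : (quasiSplit F E c N).Adelic) * (Quotient.out (x : (quasiSplit F E c N).Adelic ⧸ (quasiSplit F E c N).quotientSubgroup))⁻¹) := by
  have hsurj : Function.Surjective ((quasiSplit F E c N).toAdelic.rangeRestrict : (quasiSplit F E c N).Rational → (quasiSplit F E c N).arithmeticSubgroup) :=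
    MonoidHom.rangeRestrict_surjective _
  unfold K2E1BLBorelSpacesU2Defs.supHeight
  exact hsurj.iSup_comp (fun γ' : (quasiSplit F E c N).arithmeticSubgroup =>
    borelHeight ((γ' : (quasiSplit F E c N).Adelic) * (Quotient.out (x : (quasiSplit F E c N).Adelic ⧸ (quasiSplit F E c N).quotientSubgroup))⁻¹))

variable (L : Type) [Field L] [NumberField L] [IsCMField L]

/-- **`c₀ ≤ w₁` AT THE CM PAIR** (`N = 2`): there is `c₀ > 0` with `c₀ ≤ w₁(x)` for every `x ∈ 𝔛` (★ BL-R1 `exists_pos_forall_lt_ciSup_borelHeight_mul_cm` at the representative `x̃⁻¹`, §2 re-indexing).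
[cite: BernsteinLapid2019, §4 p. 10] [cite: Borel1963, §5] -/
theorem exists_pos_forall_le_supHeight_cm :
    ∃ c₀ : ℝ≥0, 0 < c₀ ∧ ∀ x : (quasiSplit (↥(maximalRealSubfield L)) L (IsCMField.complexConj L) 2).automorphicQuotient,
      c₀ ≤ K2E1BLBorelSpacesU2Defs.supHeight (↥(maximalRealSubfield L)) L (IsCMField.complexConj L) 2 x := by
  obtain ⟨c₀, hc₀, h⟩ := exists_pos_forall_lt_ciSup_borelHeight_mul_cm L
  refine ⟨c₀, hc₀, fun x => ?_⟩
  rw [supHeight_eq_ciSup_arithmetic]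
  exact (h _).le

end SupHeight

/-! ## §3 Moderate growth in `w₁`-currency ⟹ membership in `𝓗_k(𝔛) = L²(𝔛; w₁^{−2k}μ)` -/

section Membership

variable [NeZero N]

/-- **MODERATE GROWTH ⟹ `𝓗_k(𝔛)`** (the shape of (b1) «`E(φ₀H^z) ∈ HX k` for `k ≥ ⌈Re z⌉ + 1`»): let `μ` be a finite measure on `𝔛`, `w₁ = supHeight` measurable (letter `hw`, P2a) with `c₀ ≤ w₁`
(`c₀ > 0`, §2 at the CM pair), and `Φ : 𝔛 → ℂ` a.e.-strongly measurable with the moderate growth `‖Φ x‖ ≤ C·w₁(x)^n`.  Then `Φ ∈ L²(𝔛; w₁^{−2k}·μ)` for every `k ≥ n`: the density form of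
`HX k μ`'s measure, `‖Φ‖²·w₁^{−2k} ≤ C²·c₀^{−2(k−n)}` pointwise (Mathlib `integrable_withDensity_iff_integrable_smul`, `memLp_two_iff_integrable_sq_norm`).
[cite: BernsteinLapid2019, §4 p. 10] [cite: MoeglinWaldspurger1995, I.2.13] -/
theorem memLp_two_withDensity_supHeight_of_norm_le_mul_pow
    {μ : Measure (quasiSplit F E c N).automorphicQuotient} [IsFiniteMeasure μ]
    (hw : Measurable (K2E1BLBorelSpacesU2Defs.supHeight F E c N)) {c₀ : ℝ≥0} (hc₀ : 0 < c₀) (hwc : ∀ x, c₀ ≤ K2E1BLBorelSpacesU2Defs.supHeight F E c N x)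
    {Φ : (quasiSplit F E c N).automorphicQuotient → ℂ} (hΦm : AEStronglyMeasurable Φ μ) {C : ℝ} {n : ℕ}
    (hmod : ∀ x, ‖Φ x‖ ≤ C * ((K2E1BLBorelSpacesU2Defs.supHeight F E c N x : ℝ)) ^ n) {k : ℕ} (hk : n ≤ k) :
    MemLp Φ 2 (μ.withDensity fun x => (((K2E1BLBorelSpacesU2Defs.supHeight F E c N x)⁻¹ ^ (2 * k) : ℝ≥0) : ℝ≥0∞)) := by
  obtain ⟨j, rfl⟩ := Nat.exists_eq_add_of_le hk
  have hdm : Measurable fun x => (K2E1BLBorelSpacesU2Defs.supHeight F E c N x)⁻¹ ^ (2 * (n + j)) := (hw.inv).pow_const _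
  have hΦm' : AEStronglyMeasurable Φ (μ.withDensity fun x => (((K2E1BLBorelSpacesU2Defs.supHeight F E c N x)⁻¹ ^ (2 * (n + j)) : ℝ≥0) : ℝ≥0∞)) :=
    hΦm.mono_ac (withDensity_absolutelyContinuous _ _)
  rw [memLp_two_iff_integrable_sq_norm hΦm', integrable_withDensity_iff_integrable_smul hdm]
  -- the weighted square is bounded: `w₁^{−2(n+j)}·‖Φ‖² ≤ c₀^{−2j}·C²`
  refine Integrable.mono' (integrable_const (((c₀ : ℝ)⁻¹) ^ (2 * j) * C ^ 2)) ?_ (ae_of_all _ fun x => ?_)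
  · exact ((measurable_coe_nnreal_real.comp hdm).aestronglyMeasurable).smul (hΦm.norm.pow 2)
  · set w : ℝ := (K2E1BLBorelSpacesU2Defs.supHeight F E c N x : ℝ) with hwdef
    have hw0 : 0 < w := lt_of_lt_of_le (by exact_mod_cast hc₀) (by exact_mod_cast hwc x)
    have hwc' : (c₀ : ℝ) ≤ w := by exact_mod_cast hwc x
    have hΦ : ‖Φ x‖ ≤ C * w ^ n := hmod x
    rw [NNReal.smul_def, smul_eq_mul, Real.norm_eq_abs, NNReal.coe_pow, NNReal.coe_inv, abs_of_nonneg (by positivity)]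
    have h1 : ‖Φ x‖ ^ 2 ≤ (C * w ^ n) ^ 2 := pow_le_pow_left₀ (norm_nonneg _) hΦ 2
    have h2 : (w⁻¹) ^ (2 * (n + j)) * (C * w ^ n) ^ 2 = (w⁻¹) ^ (2 * j) * C ^ 2 := by
      have : (w⁻¹) ^ (2 * (n + j)) * (w ^ n) ^ 2 = (w⁻¹) ^ (2 * j) := by
        rw [show 2 * (n + j) = 2 * j + 2 * n by ring, pow_add, ← pow_mul, mul_comm n 2, mul_assoc, ← mul_pow, inv_mul_cancel₀ hw0.ne', one_pow, mul_one]
      calc (w⁻¹) ^ (2 * (n + j)) * (C * w ^ n) ^ 2 = C ^ 2 * ((w⁻¹) ^ (2 * (n + j)) * (w ^ n) ^ 2) := by ring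
        _ = (w⁻¹) ^ (2 * j) * C ^ 2 := by rw [this]; ring
    have h3 : (w⁻¹) ^ (2 * j) ≤ ((c₀ : ℝ)⁻¹) ^ (2 * j) :=
      pow_le_pow_left₀ (inv_nonneg.2 hw0.le) ((inv_le_inv₀ hw0 (by exact_mod_cast hc₀)).2 hwc') _
    calc (w⁻¹) ^ (2 * (n + j)) * ‖Φ x‖ ^ 2 ≤ (w⁻¹) ^ (2 * (n + j)) * (C * w ^ n) ^ 2 := mul_le_mul_of_nonneg_left h1 (by positivity)
      _ = (w⁻¹) ^ (2 * j) * C ^ 2 := h2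
      _ ≤ ((c₀ : ℝ)⁻¹) ^ (2 * j) * C ^ 2 := mul_le_mul_of_nonneg_right h3 (sq_nonneg C)

end Membership

end Summit.HodgeConjecture.HodgeConjecture.Cruxes.H413.K2E1BLEisensteinInWeightedSpaceU2Weights

end
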